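import Literature.AlgebraicGeometry.Resolution.AlterationsNormalFormBlowupChartsFormalProofs
import Literature.AlgebraicGeometry.Resolution.PowerSeriesRegularLocal
import Literature.RingTheory.MvPowerSeries.MaximalIdealPow
import HarnessLib

/-!
# [OURS · L1 W4.6, rungs (i)/(ii) — the dictionary, SCHEME HALF, brick 1] Formal-chart recognition:
# a complete local ring receiving `κ⟦X⟧` through a blow-up chart at a `κ`-rational point IS `κ⟦X⟧`,
# and the received map IS the chart substitution `X_j ↦ X_i (X_j + τ_j)`

Cell res-hironaka (LADDER-RESOLUTION rung L, D-0089), slot W4.6 «restricted regimes as rungs of the typed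
Th. 16.6 procedure», seat res-L1-s46-pv-2 (gen 2): «(i) SURFACES, second prover … Lipman normalised blow-up
dictionary as in `ClassicalRegimes` n = 2, or the embedded-surface-in-3-space variant». Host: route `WildCones`,
crux `ClassicalRegimes` (stmt-ResolutionOfSingularities-16884), `--supports … --as helper`.

HONEST FRAMING. Everything here is OURS and is ordinary commutative algebra (Cohen / complete Nakayama);
NOTHING here is a statement of H. Hironaka's manuscript [Hironaka2017] and nothing of it is used; no FACT-LIST
premise is used. AI review is weaker than expert review.

## What this file is for

`Theorems/WildConesCampaignW46FormalDictionary.lean` (this seat, gen 0) proved the FORMAL half of the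
dictionary between route `WildCones`' coefficient dynamics and point blow-ups: the chart substitution
`Ψ = σ_{i,τ}` followed by the cleaning shift carries `z^p − a` to `u_i^p (z^p − a′)`. Its docstring names the
SCHEME half (S1): «for the typed Th. 16.6 procedure (`CampaignW46.Step`: a blow-up `IsBlowup π 𝓘_D` of an ambient
datum along a closed point) the completed local ring of `Z′` at a closed point of `π⁻¹(ξ)` is `κ(ξ′)⟦z,u⟧` with
`π^♯` inducing `Ψ`». This file is the RECOGNITION STEP of (S1), isolated as pure algebra so that the remaining
steps are ring-level bookkeeping about blow-up charts (tree `BlowupChartRsop.lean`, `BlowupCharts.lean`,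
`BlowupStalkCharts.lean`):

**Theorem** (`exists_ringEquiv_chart`). Let `κ` be a field, `σ` a finite index set, `C` a complete Noetherian
local ring and `φ : κ⟦X_σ⟧ → C` a ring map (in the application: the completed stalk map `𝒪̂_{Z,ξ} → 𝒪̂_{Z′,ξ′}`
composed with formal coordinates at `ξ`). Suppose
* every element of `C` is a constant `φ(c)` modulo `𝔪_C` (the point `ξ′` is `κ(ξ)`-rational);
* for an index `i` there are `e_j ∈ C` with `φ(X_j) = φ(X_i) · e_j` (`ξ′` lies in the chart `X_i` of the
  blow-up of the closed point: the exceptional ideal `𝔪_ξ 𝒪_{Z′,ξ′}` is generated by `X_i`);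
* `𝔪_C` is generated by `φ(X_i)` and the recentred quotients `e_j − τ_j` (`j ≠ i`), `τ_j ∈ κ` (the affine
  coordinates of `ξ′` on the exceptional divisor `ℙ(𝔪_ξ/𝔪_ξ²)` in the chart `X_i ≠ 0`);
* `dim C = |σ|`.
Then there is a ring isomorphism `E : C ≅ κ⟦X_σ⟧` with `E(φ(c)) = c`, `E(φ(X_i)) = X_i`,
`E(e_j) = X_j + τ_j`, hence `E(φ(X_j)) = X_i (X_j + τ_j)` (`j ≠ i`); and (`ringEquiv_comp_eq_subst`) the
composite `E ∘ φ` IS the substitution endomorphism `f ↦ f(σ_{i,τ})`, `σ_{i,τ}(X_i) = X_i`,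
`σ_{i,τ}(X_j) = X_i (X_j + τ_j)` — for `σ = Fin n` literally route `FrobeniusClosing`'s `chartMap n κ i τ`
(`Theorems/FrobeniusClosingDefs.lean`), the `u`-part of `FormalDictionary.blowupChart`.

So, once the three bulleted ring-level facts are supplied for the local ring of a point blow-up at a rational
point of the exceptional divisor (they are the content of Stacks 0804 / `chartQuotEquiv`: `B_i/(X_i) ≅ κ[T_j]`),
«`π^♯` on completed local rings is the chart substitution» is a THEOREM, not a reading. The vertical recentring
by the cleaning shift (`z ↦ z + (r − r(0))`, a `κ⟦u⟧`-automorphism) and non-rational points `ξ′` (a coefficient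
field `κ(ξ′) ⊇ κ(ξ)`, separable since the fields of the campaign are perfect) are the next bricks and are NOT
claimed here.

## Method

Matsumura Thm. 8.4 / 29.7 as landed in the tree for de Jong's formal charts
(`Literature.AlgebraicGeometry.Resolution.exists_mvPowerSeries_ringHom_surjective`,
`RingHom.injective_of_surjective_of_isDomain_of_ringKrullDim_eq`, file
`AlterationsNormalFormBlowupChartsFormalProofs.lean`): the substitution `κ⟦X⟧ → C` onto the given generators of
`𝔪_C` is surjective by complete Nakayama and injective by dimension count (`ringKrullDim_mvPowerSeries`,
`PowerSeriesRegularLocal.lean`); we record it for an arbitrary finite index type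
(`exists_ringEquiv_mvPowerSeries_of_generators`). The identification of `E ∘ φ` with the substitution is
`Literature.RingTheory.MvPowerSeries.Jets.algHom_ext_X` (every `κ`-algebra endomorphism of `κ⟦X⟧` is determined
by its values on the variables, `MaximalIdealPow.lean`).

References: H. Matsumura, *Commutative Ring Theory* (CUP 1986/1989), Thm. 8.4, Thm. 29.7; The Stacks Project, Tag 0804;
route file `Theses/WildCones.lean` (crux `ClassicalRegimes`: «the dictionary state ↦ local ring of the strict
transform»); H. Hironaka, ms. 2017, Th. 16.6 p.84 — quoted for the ROLE of «the blowup `π : Z′ → Z`» only,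
under adjudication, not cited as fact. [Matsumura1987] [StacksProject] [folklore]
-/

noncomputable section

-- single-problem summit: the doubled namespace component `ResolutionOfSingularities` is forced
set_option linter.dupNamespace false

open IsLocalRing MvPowerSeries

namespace Summit.ResolutionOfSingularities.ResolutionOfSingularities.Theorems

namespace CampaignW46.FormalChart

open Literature.AlgebraicGeometry.Resolution
open Literature.RingTheory.MvPowerSeries.Jets (algHom_ext_X)

universe u

variable {κ : Type u} [Field κ] {C : Type u} [CommRing C] [IsLocalRing C] [IsNoetherianRing C]
  [IsAdicComplete (maximalIdeal C) C] {σ : Type} [Fintype σ] [DecidableEq σ]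

/-! ## Recognition of `κ⟦X_σ⟧` by generators of the maximal ideal (any finite index type) -/

omit [DecidableEq σ] in
/-- [OURS · L1 W4.6] **Recognition of the regular formal model, finite index type.** If `ι : κ → C` maps onto
the residue field of the complete Noetherian local ring `C`, `𝔪_C` is generated by a family `x : σ → C` and
`dim C = |σ|`, then `C ≅ κ⟦X_σ⟧` with `x_j ↦ X_j` and `ι(c) ↦ c` (Matsumura 8.4 + 29.7; the tree's `Fin n`
version is `exists_ringEquiv_mvPowerSeries_of_generators` of `AlterationsNormalFormBlowupChartsFormalProofs`).
[cite: Matsumura1987, Thm. 29.7] [folklore] -/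
theorem exists_ringEquiv_mvPowerSeries_of_generators (ι : κ →+* C)
    (hι : ∀ c : C, ∃ l : κ, c - ι l ∈ maximalIdeal C) (x : σ → C)
    (hx : Ideal.span (Set.range x) = maximalIdeal C) (hdim : ringKrullDim C = Fintype.card σ) :
    ∃ E : C ≃+* MvPowerSeries σ κ, (∀ j, E (x j) = X j) ∧ ∀ l, E (ι l) = MvPowerSeries.C l := by
  obtain ⟨Ψ, hΨX, hΨC, hsurj⟩ := exists_mvPowerSeries_ringHom_surjective ι hι x hx
  haveI : IsDomain (MvPowerSeries σ κ) := NoZeroDivisors.to_isDomain _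
  have hinj := RingHom.injective_of_surjective_of_isDomain_of_ringKrullDim_eq Ψ hsurj
    (Fintype.card σ) (by rw [ringKrullDim_mvPowerSeries κ σ, Nat.card_eq_fintype_card]) hdim
  let E := (RingEquiv.ofBijective Ψ ⟨hinj, hsurj⟩).symm
  refine ⟨E, fun j => ?_, fun l => ?_⟩
  · apply (RingEquiv.ofBijective Ψ ⟨hinj, hsurj⟩).injective
    rw [RingEquiv.apply_symm_apply, RingEquiv.ofBijective_apply, hΨX]
  · apply (RingEquiv.ofBijective Ψ ⟨hinj, hsurj⟩).injective
    rw [RingEquiv.apply_symm_apply, RingEquiv.ofBijective_apply, hΨC]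

/-! ## The formal chart of a point blow-up at a rational point of the exceptional divisor -/

/-- [OURS · L1 W4.6 — DICTIONARY, SCHEME HALF, brick 1; replaces the role of «the blowup `π : Z′ → Z` with
center `D`» of H. Hironaka, ms. 2017, Th. 16.6 p.84 l.4–8 ON COMPLETED LOCAL RINGS AT A RATIONAL POINT; NOT a
statement of the manuscript] **Formal-chart recognition.** Let `φ : κ⟦X_σ⟧ → C` be a ring map into a
complete Noetherian local ring whose elements are constants `φ(c)` modulo `𝔪_C`; let `i ∈ σ` and
`e : σ → C` with `φ(X_j) = φ(X_i) e_j` for `j ≠ i`; let `τ : σ → κ` and suppose `𝔪_C` is generated by `φ(X_i)`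
and the `e_j − φ(τ_j)` (`j ≠ i`), and `dim C = |σ|`. Then `C ≅ κ⟦X_σ⟧` by an `E` with `E ∘ φ = id` on
constants, `E(φ X_i) = X_i`, `E(e_j) = X_j + τ_j` and `E(φ X_j) = X_i (X_j + τ_j)` for `j ≠ i`.
[cite: Matsumura1987, Thm. 29.7] [folklore] -/
theorem exists_ringEquiv_chart (φ : MvPowerSeries σ κ →+* C)
    (hres : ∀ c : C, ∃ l : κ, c - φ (MvPowerSeries.C l) ∈ maximalIdeal C)
    (i : σ) (e : σ → C) (he : ∀ j, j ≠ i → φ (X j) = φ (X i) * e j) (τ : σ → κ)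
    (hgen : Ideal.span (Set.range fun j : σ =>
        if j = i then φ (X i) else e j - φ (MvPowerSeries.C (τ j))) = maximalIdeal C)
    (hdim : ringKrullDim C = Fintype.card σ) :
    ∃ E : C ≃+* MvPowerSeries σ κ,
      (∀ l, E (φ (MvPowerSeries.C l)) = MvPowerSeries.C l) ∧ E (φ (X i)) = X i ∧
      (∀ j, j ≠ i → E (e j) = X j + MvPowerSeries.C (τ j)) ∧
      (∀ j, j ≠ i → E (φ (X j)) = X i * (X j + MvPowerSeries.C (τ j))) := by
  obtain ⟨E, hEx, hEC⟩ := exists_ringEquiv_mvPowerSeries_of_generators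
    (φ.comp MvPowerSeries.C) (fun c => hres c) _ hgen hdim
  have hEi : E (φ (X i)) = X i := by simpa using hEx i
  have hEe : ∀ j, j ≠ i → E (e j) = X j + MvPowerSeries.C (τ j) := by
    intro j hj
    have h := hEx j
    rw [if_neg hj, map_sub] at h
    have hC : E (φ (MvPowerSeries.C (τ j))) = MvPowerSeries.C (τ j) := hEC (τ j)
    rw [hC, sub_eq_iff_eq_add] at h
    exact h
  refine ⟨E, fun l => hEC l, hEi, hEe, fun j hj => ?_⟩
  rw [he j hj, map_mul, hEi, hEe j hj]

/-! ## `E ∘ φ` is the chart substitution -/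

/-- The chart substitution family `σ_{i,τ}`: `X_i ↦ X_i`, `X_j ↦ X_i (X_j + τ_j)` (`j ≠ i`) is substitutable
(no constant terms). For `σ = Fin n` this is route `FrobeniusClosing`'s `chartSubst n κ i τ`. [folklore] -/
theorem hasSubst_chart (i : σ) (τ : σ → κ) :
    HasSubst (fun j : σ => if j = i then (X i : MvPowerSeries σ κ)
      else X i * (X j + MvPowerSeries.C (τ j))) := by
  refine hasSubst_of_constantCoeff_zero fun j => ?_
  by_cases hj : j = i
  · simp [hj]
  · simp [hj]

/-- [OURS · L1 W4.6] A ring endomorphism of `κ⟦X_σ⟧` fixing the constants and taking the values of the chart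
substitution on the variables IS the chart substitution (every `κ`-algebra endomorphism of `κ⟦X⟧` is
determined by its values on the variables, `Jets.algHom_ext_X`). [folklore] -/
theorem ringHom_eq_subst_of_apply_X (g : MvPowerSeries σ κ →+* MvPowerSeries σ κ)
    (hC : ∀ l, g (MvPowerSeries.C l) = MvPowerSeries.C l) (i : σ) (τ : σ → κ) (hXi : g (X i) = X i)
    (hXj : ∀ j, j ≠ i → g (X j) = X i * (X j + MvPowerSeries.C (τ j))) (f : MvPowerSeries σ κ) :
    g f = subst (fun j : σ => if j = i then (X i : MvPowerSeries σ κ)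
      else X i * (X j + MvPowerSeries.C (τ j))) f := by
  let gₐ : MvPowerSeries σ κ →ₐ[κ] MvPowerSeries σ κ :=
    { g with
      commutes' := fun l => by
        simp only [RingHom.toMonoidHom_eq_coe, OneHom.toFun_eq_coe, MonoidHom.toOneHom_coe,
          MonoidHom.coe_coe, MvPowerSeries.algebraMap_apply, Algebra.algebraMap_self, RingHom.id_apply]
        exact hC l }
  have key : gₐ = substAlgHom (hasSubst_chart i τ) := by
    apply algHom_ext_X
    intro s
    rw [substAlgHom_apply, subst_X (hasSubst_chart i τ)]
    by_cases hs : s = i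
    · subst hs; simp only [if_true]; exact hXi
    · rw [if_neg hs]; exact hXj s hs
  have h := congrArg (fun χ => χ f) key
  simp only [substAlgHom_apply] at h
  exact h

/-- [OURS · L1 W4.6 — DICTIONARY, SCHEME HALF, brick 1, packaged; replaces the role of «the blowup
`π : Z′ → Z` with center `D`» of H. Hironaka, ms. 2017, Th. 16.6 p.84 ON COMPLETED LOCAL RINGS AT A RATIONAL
POINT; NOT a statement of the manuscript] Under the hypotheses of `exists_ringEquiv_chart` there is
`E : C ≅ κ⟦X_σ⟧` such that **`E ∘ φ` is the chart substitution `σ_{i,τ}`**: `E (φ f) = f(σ_{i,τ})` for every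
series `f`. [cite: Matsumura1987, Thm. 29.7] [folklore] -/
theorem ringEquiv_comp_eq_subst (φ : MvPowerSeries σ κ →+* C)
    (hres : ∀ c : C, ∃ l : κ, c - φ (MvPowerSeries.C l) ∈ maximalIdeal C)
    (i : σ) (e : σ → C) (he : ∀ j, j ≠ i → φ (X j) = φ (X i) * e j) (τ : σ → κ)
    (hgen : Ideal.span (Set.range fun j : σ =>
        if j = i then φ (X i) else e j - φ (MvPowerSeries.C (τ j))) = maximalIdeal C)
    (hdim : ringKrullDim C = Fintype.card σ) :
    ∃ E : C ≃+* MvPowerSeries σ κ,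
      E (φ (X i)) = X i ∧ (∀ j, j ≠ i → E (e j) = X j + MvPowerSeries.C (τ j)) ∧
      ∀ f, E (φ f) = subst (fun j : σ => if j = i then (X i : MvPowerSeries σ κ)
        else X i * (X j + MvPowerSeries.C (τ j))) f := by
  obtain ⟨E, hEC, hEi, hEe, hEj⟩ := exists_ringEquiv_chart φ hres i e he τ hgen hdim
  refine ⟨E, hEi, hEe, fun f => ?_⟩
  exact ringHom_eq_subst_of_apply_X ((E : C →+* MvPowerSeries σ κ).comp φ) hEC i τ hEi hEj f

/-! ## Vertical recentring: the shear `X_z ↦ X_z + s` by a series `s` not involving `X_z` -/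

/-- The «kill `X_z`» family `X_z ↦ 0`, `X_j ↦ X_j` is substitutable. [folklore] -/
theorem hasSubst_kill (z : σ) :
    HasSubst (fun j : σ => if j = z then (0 : MvPowerSeries σ κ) else X j) :=
  hasSubst_of_constantCoeff_zero fun j => by by_cases hj : j = z <;> simp [hj]

/-- The shear family `X_z ↦ X_z + s`, `X_j ↦ X_j` is substitutable when `s(0) = 0`. [folklore] -/
theorem hasSubst_shear (z : σ) {s : MvPowerSeries σ κ} (hs0 : constantCoeff s = 0) :
    HasSubst (fun j : σ => if j = z then X z + s else (X j : MvPowerSeries σ κ)) :=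
  hasSubst_of_constantCoeff_zero fun j => by by_cases hj : j = z <;> simp [hj, hs0]

/-- A series not involving `X_z` (fixed by killing `X_z`) is fixed by every shear along `X_z`. [folklore] -/
theorem shear_apply_of_kill_eq (z : σ) {s t : MvPowerSeries σ κ} (ht0 : constantCoeff t = 0)
    (hs : subst (fun j : σ => if j = z then (0 : MvPowerSeries σ κ) else X j) s = s) :
    substAlgHom (hasSubst_shear z ht0) s = s := by
  conv_lhs => rw [← hs]
  rw [substAlgHom_apply, subst_comp_subst_apply (hasSubst_kill z) (hasSubst_shear z ht0)]
  conv_rhs => rw [← hs]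
  congr 1
  funext j
  by_cases hj : j = z
  · simp only [hj, if_true]
    rw [← substAlgHom_apply (hasSubst_shear z ht0), map_zero]
  · simp only [if_neg hj]
    rw [subst_X (hasSubst_shear z ht0), if_neg hj]

/-- Opposite shears cancel: if `s + t = 0` and `s` does not involve `X_z`, the shear by `t` after the
shear by `s` is the identity. [folklore] -/
theorem shear_comp_shear_eq_id (z : σ) {s t : MvPowerSeries σ κ} (hs0 : constantCoeff s = 0)
    (ht0 : constantCoeff t = 0) (hst : s + t = 0)
    (hs : subst (fun j : σ => if j = z then (0 : MvPowerSeries σ κ) else X j) s = s) :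
    (substAlgHom (hasSubst_shear z ht0)).comp (substAlgHom (hasSubst_shear z hs0)) =
      AlgHom.id κ (MvPowerSeries σ κ) := by
  apply algHom_ext_X
  intro j
  rw [AlgHom.comp_apply, substAlgHom_apply (hasSubst_shear z hs0), subst_X (hasSubst_shear z hs0),
    AlgHom.id_apply]
  by_cases hj : j = z
  · subst hj
    have h1 : substAlgHom (hasSubst_shear j ht0) (X j : MvPowerSeries σ κ) = X j + t := by
      rw [substAlgHom_apply, subst_X (hasSubst_shear j ht0), if_pos rfl]
    have h2 := shear_apply_of_kill_eq j ht0 hs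
    rw [if_pos rfl, map_add, h1, h2, add_assoc, add_comm t s, hst, add_zero]
  · rw [if_neg hj, substAlgHom_apply, subst_X (hasSubst_shear z ht0), if_neg hj]

/-- [OURS · L1 W4.6] **The shear automorphism.** For `s ∈ κ⟦X_σ⟧` with `s(0) = 0` not involving the variable
`X_z`, there is a `κ`-algebra automorphism `θ` of `κ⟦X_σ⟧` with `θ(X_z) = X_z + s` and `θ(X_j) = X_j` for
`j ≠ z` (inverse: the shear by `−s`). In the dictionary this is the CLEANING of the fibre coordinate,
`z ↦ z + (r − r(0))`. [folklore] -/
theorem exists_algEquiv_shear (z : σ) (s : MvPowerSeries σ κ) (hs0 : constantCoeff s = 0)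
    (hs : subst (fun j : σ => if j = z then (0 : MvPowerSeries σ κ) else X j) s = s) :
    ∃ θ : MvPowerSeries σ κ ≃ₐ[κ] MvPowerSeries σ κ,
      θ (X z) = X z + s ∧ ∀ j, j ≠ z → θ (X j) = X j := by
  have hn0 : constantCoeff (-s) = 0 := by rw [map_neg, hs0, neg_zero]
  have hns : subst (fun j : σ => if j = z then (0 : MvPowerSeries σ κ) else X j) (-s) = -s := by
    rw [← substAlgHom_apply (hasSubst_kill z), map_neg, substAlgHom_apply, hs]
  have h₁ := shear_comp_shear_eq_id z hs0 hn0 (add_neg_cancel s) hs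
  have h₂ := shear_comp_shear_eq_id z hn0 hs0 (neg_add_cancel s) hns
  refine ⟨AlgEquiv.ofAlgHom (substAlgHom (hasSubst_shear z hs0)) (substAlgHom (hasSubst_shear z hn0))
    h₂ h₁, ?_, fun j hj => ?_⟩
  · rw [AlgEquiv.ofAlgHom_apply, substAlgHom_apply, subst_X (hasSubst_shear z hs0), if_pos rfl]
  · rw [AlgEquiv.ofAlgHom_apply, substAlgHom_apply, subst_X (hasSubst_shear z hs0), if_neg hj]

/-- [OURS · L1 W4.6 — DICTIONARY, SCHEME HALF, brick 1 with CLEANING; replaces the role of «the blowup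
`π : Z′ → Z` with center `D`» of H. Hironaka, ms. 2017, Th. 16.6 p.84 ON COMPLETED LOCAL RINGS AT A RATIONAL
POINT, in cleaned fibre coordinate; NOT a statement of the manuscript] **Formal chart with vertical
recentring.** Under the hypotheses of `exists_ringEquiv_chart`, for a fibre index `z ≠ i` and a series `s` with
`s(0) = 0` not involving `X_z`, there is `E′ : C ≅ κ⟦X_σ⟧`, constant on constants, with `E′(φ X_i) = X_i`,
`E′(φ X_j) = X_i (X_j + τ_j)` for `j ∉ {i, z}`, and `E′(φ X_z) = X_i (X_z + τ_z + s)` — with `s = r − r(0)`,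
`τ_z = r(0)` this is `u_i (z + r)`, the value of `FormalDictionary.blowupChart` on `z`. [folklore] -/
theorem exists_ringEquiv_chart_shear (φ : MvPowerSeries σ κ →+* C)
    (hres : ∀ c : C, ∃ l : κ, c - φ (MvPowerSeries.C l) ∈ maximalIdeal C)
    (i : σ) (e : σ → C) (he : ∀ j, j ≠ i → φ (X j) = φ (X i) * e j) (τ : σ → κ)
    (hgen : Ideal.span (Set.range fun j : σ =>
        if j = i then φ (X i) else e j - φ (MvPowerSeries.C (τ j))) = maximalIdeal C)
    (hdim : ringKrullDim C = Fintype.card σ) (z : σ) (hz : z ≠ i) (s : MvPowerSeries σ κ)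
    (hs0 : constantCoeff s = 0)
    (hs : subst (fun j : σ => if j = z then (0 : MvPowerSeries σ κ) else X j) s = s) :
    ∃ E : C ≃+* MvPowerSeries σ κ,
      (∀ l, E (φ (MvPowerSeries.C l)) = MvPowerSeries.C l) ∧ E (φ (X i)) = X i ∧
      (∀ j, j ≠ i → j ≠ z → E (φ (X j)) = X i * (X j + MvPowerSeries.C (τ j))) ∧
      E (φ (X z)) = X i * (X z + MvPowerSeries.C (τ z) + s) := by
  obtain ⟨E, hEC, hEi, -, hEj⟩ := exists_ringEquiv_chart φ hres i e he τ hgen hdim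
  obtain ⟨θ, hθz, hθj⟩ := exists_algEquiv_shear z s hs0 hs
  have hθC : ∀ l, θ (MvPowerSeries.C l) = MvPowerSeries.C l := fun l => by
    rw [MvPowerSeries.c_eq_algebraMap]; exact θ.commutes l
  refine ⟨E.trans θ.toRingEquiv, fun l => ?_, ?_, fun j hj hjz => ?_, ?_⟩
  · rw [RingEquiv.trans_apply, hEC]; exact hθC l
  · rw [RingEquiv.trans_apply, hEi]; exact hθj i hz.symm
  · rw [RingEquiv.trans_apply, hEj j hj]
    change θ (X i * (X j + MvPowerSeries.C (τ j))) = _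
    rw [map_mul, map_add, hθj i hz.symm, hθj j hjz, hθC]
  · rw [RingEquiv.trans_apply, hEj z hz]
    change θ (X i * (X z + MvPowerSeries.C (τ z))) = _
    rw [map_mul, map_add, hθj i hz.symm, hθz, hθC]
    ring

end CampaignW46.FormalChart

end Summit.ResolutionOfSingularities.ResolutionOfSingularities.Theorems

end
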